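import Summits.Ventures.HodgeKum4.Theorems.KummerFixedLocusHodgeIndexDischarged
import Literature.AlgebraicGeometry.GroupActions.FixedLocusTangentDimensionHolds
import HarnessLib

/-!
# Route `KummerFixedLocus`: the tangent-dimension input DISCHARGED — Route A and the closers of record with one binder fewer (cell `hodge-kum4`, seat p2 g9)

HONEST FRAMING.  Nothing here proves L1, `HC_Kum4Type` or the Hodge conjecture outright.  Every theorem is
CONDITIONAL on the printed statements it names — named Literature facts taken as hypotheses — and, where stated,
on p1's cell lemma L1 (`LefschetzGenerationKum4`).  What changes with this file, and nothing else: the REFEREED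
(textbook) input `GroupActions.Milne2017_fixedComponent_dim_eq_finrank_tangentFixed` (Iversen / Fogarty / Cartan;
Milne, *Algebraic Groups* Thm. 13.1, Conrad–Gabber–Prasad A.8.10, Görtz–Wedhorn 6.28: the member of a smooth
projective partition of `Fix(φ)` through a fixed point `P` has dimension `dim ker(dφ_P − 1)`), the binder `hTan`
(`hT`) of every landed Route-A theorem and closer, is now a THEOREM of the tree:
`GroupActions.Milne2017_fixedComponent_dim_eq_finrank_tangentFixed_holds`
(`Literature/AlgebraicGeometry/GroupActions/FixedLocusTangentDimensionHolds`; kernel proof: Hodge model `X^an`,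
GAGA for automorphisms, H. Cartan's holomorphic linearisation — discharged by the cell's literature family —, the
complex points of closed immersions and of proper varieties, and invariance of dimension at a point by local
homology).  Each theorem below is a landed one with that binder SUPPLIED BY THE THEOREM — one-line applications,
no new mathematics on this side, no new named fact, outside the route file's import cone.

WHAT IS PROVED (all CONDITIONAL on the remaining named facts):
* Route A at the Kummer varieties from TWO REFEREED facts (`Γ ≅ (ℤ/5)⁴`, Oguiso's `125` reduced fixed points):
  the transitivity (H2) `oguiso2020_translations_transitive_of_split`, the atom (H3)
  `kum4FixedFourfoldHasFixedPointAtKummer_of_split` (item stmt-Ventures-19595 by name), the point count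
  `kum4FixedPointCountAtKummer_of_split` (item stmt-Ventures-19504 by name) and the restricted residual
  `kum4FixedFourfoldMeetsTranslatesAtKummer_of_split` (was three facts each: `…_of_tangentFixed'`,
  `…_of_split_oguiso`).
* Route A on every `X` of `Kum⁴`-type from TWO named facts (`Γ ≅ (ℤ/5)⁴` REFEREED, F125X PRINT-SYNTHESIS): the
  route's original residual I1geo `kum4FixedFourfoldMeetsTranslates_of_split125'` (was three).
* `kum4FixedFourfoldClasses_of_L1_of_split125'` (crux I) and `kum4NonInvariantClassesAlgebraic_of_L1_of_split125'`
  (L3°, the statement of item stmt-Ventures-19135 by name) from EIGHT named facts (SEVEN REFEREED + F125X) + L1.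
* `hc_kum4Type_of_L1_of_split125'''` — **bill A‴ of record with TWELVE binders** = ELEVEN named Literature facts
  (TEN REFEREED: O'Grady–Voisin `KS ~ J³`, Floccari–Fu, Foster `B(X)`, Hirzebruch `g`-signature, Floccari's fixed
  fourfold, Göttsche–Soergel `χ_y`, GKLR LLV-trivial classes, Foster's translation action, Fulton's transversal
  pairing, `Γ ≅ (ℤ/5)⁴`; ONE PRINT-SYNTHESIS: F125X) + L1 ⇒ `HC_Kum4Type ∧ HC_Kum4TypePowers`
  (was thirteen, `hc_kum4Type_of_L1_of_split125''`, p471473).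
* `hc_kum4Type_of_L1_of_tangentFixed''''` — the alternative bill A′ with THIRTEEN binders (was fourteen).
Rung currency (the cell's words are the director's, not this file's): the count of named print inputs of the
by-name closer of record drops from 12 (11 REFEREED + F125X) to 11 (10 REFEREED + F125X) + L1; open mathematics
unchanged (`{MODEL_X computed clause (19267)}`).
-/

noncomputable section

open CategoryTheory CategoryTheory.Limits MonoidalCategory
open Literature.AlgebraicGeometry Literature.AlgebraicGeometry.Motives
open Literature.AlgebraicGeometry.Hyperkaehler Literature.AlgebraicGeometry.GroupActions
open Literature.AlgebraicGeometry.HodgeTheory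

namespace Summit.Ventures.HodgeKum4

/-! ### Route A at the Kummer varieties from two refereed facts -/

/-- **(H2) — Oguiso's transitivity of `Γ(K)` on the `125` fixed points — from TWO REFEREED facts**
(`Γ ≅ (ℤ/5)⁴`, Oguiso 2020 Prop. 3.5–3.6): `oguiso2020_translations_transitive_of_tangentFixed` (p442732) with the
tangent-dimension binder supplied by the tree theorem `Milne2017_fixedComponent_dim_eq_finrank_tangentFixed_holds`.
CONDITIONAL on the two; the conclusion is the Literature statement BY NAME. -/
theorem oguiso2020_translations_transitive_of_split
    (hFV : FloccariVaresco2024_autFixingH2H3_equiv_kumType)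
    (hOg : Oguiso2020_fixedPointScheme_translation_generalizedKummerFour) :
    Oguiso2020_translations_transitive_fixedPoints_generalizedKummerFour :=
  oguiso2020_translations_transitive_of_tangentFixed hFV hOg
    Milne2017_fixedComponent_dim_eq_finrank_tangentFixed_holds

/-- **(H3) `Kum4FixedFourfoldHasFixedPointAtKummer` (item stmt-Ventures-19595, by name) from TWO REFEREED facts**
(`Γ ≅ (ℤ/5)⁴`, Oguiso's `125` reduced fixed points): `kum4FixedFourfoldHasFixedPointAtKummer_of_tangentFixed'` with
the tangent-dimension binder supplied by the tree theorem.  CONDITIONAL on the two; this does not close the item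
(its own signature is not proved outright). -/
theorem kum4FixedFourfoldHasFixedPointAtKummer_of_split
    (hFV : FloccariVaresco2024_autFixingH2H3_equiv_kumType)
    (hOg : Oguiso2020_fixedPointScheme_translation_generalizedKummerFour) :
    Kum4FixedFourfoldHasFixedPointAtKummer :=
  kum4FixedFourfoldHasFixedPointAtKummer_of_tangentFixed' hFV hOg
    Milne2017_fixedComponent_dim_eq_finrank_tangentFixed_holds

/-- **The point count `Kum4FixedPointCountAtKummer` (item stmt-Ventures-19504, by name) from TWO REFEREED facts**
(`Γ ≅ (ℤ/5)⁴`, Oguiso's `125` reduced fixed points): `kum4FixedPointCountAtKummer_of_tangentFixed'` with the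
tangent-dimension binder supplied by the tree theorem.  CONDITIONAL on the two; this does not close the item. -/
theorem kum4FixedPointCountAtKummer_of_split
    (hFV : FloccariVaresco2024_autFixingH2H3_equiv_kumType)
    (hOg : Oguiso2020_fixedPointScheme_translation_generalizedKummerFour) :
    Kum4FixedPointCountAtKummer :=
  kum4FixedPointCountAtKummer_of_tangentFixed' hFV hOg
    Milne2017_fixedComponent_dim_eq_finrank_tangentFixed_holds

/-- **The restricted residual `Kum4FixedFourfoldMeetsTranslatesAtKummer` from TWO REFEREED facts** (`Γ ≅ (ℤ/5)⁴`,
Oguiso's `125` reduced fixed points): `kum4FixedFourfoldMeetsTranslatesAtKummer_of_split_oguiso` (p446589) with the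
tangent-dimension binder supplied by the tree theorem.  CONDITIONAL on the two. -/
theorem kum4FixedFourfoldMeetsTranslatesAtKummer_of_split
    (hFV : FloccariVaresco2024_autFixingH2H3_equiv_kumType)
    (hOg : Oguiso2020_fixedPointScheme_translation_generalizedKummerFour) :
    Kum4FixedFourfoldMeetsTranslatesAtKummer :=
  kum4FixedFourfoldMeetsTranslatesAtKummer_of_split_oguiso hFV hOg
    Milne2017_fixedComponent_dim_eq_finrank_tangentFixed_holds

/-! ### Route A on `X` and the closers of record -/

/-- **I1geo `Kum4FixedFourfoldMeetsTranslates` (all `X` of `Kum⁴`-type) from TWO named facts**: `Γ ≅ (ℤ/5)⁴`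
(Floccari–Varesco, REFEREED) and F125X (PRINT-SYNTHESIS) — `kum4FixedFourfoldMeetsTranslates_of_split125`
(p451323) with the tangent-dimension binder supplied by the tree theorem.  CONDITIONAL on the two; nothing is
proved outright. -/
theorem kum4FixedFourfoldMeetsTranslates_of_split125'
    (hFV : FloccariVaresco2024_autFixingH2H3_equiv_kumType)
    (h125 : HassettTschinkel2013_Oguiso2020_fixedPointScheme_translation_kum4Type) :
    Kum4FixedFourfoldMeetsTranslates :=
  kum4FixedFourfoldMeetsTranslates_of_split125 hFV Milne2017_fixedComponent_dim_eq_finrank_tangentFixed_holds h125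

/-- **Crux I `Kum4FixedFourfoldClasses` from EIGHT named facts + L1** (SEVEN REFEREED: Hirzebruch `g`-signature,
Floccari's fixed fourfold, Göttsche–Soergel, GKLR, Foster's translation action, Fulton, `Γ ≅ (ℤ/5)⁴`; ONE
PRINT-SYNTHESIS: F125X): `kum4FixedFourfoldClasses_of_L1_of_split125` (p471473) with the tangent-dimension binder
supplied by the tree theorem.  CONDITIONAL on all nine; nothing is proved outright. -/
theorem kum4FixedFourfoldClasses_of_L1_of_split125'
    (hA1 : Hirzebruch1969_gSignature_involution_halfDimFixedLocus)
    (hA2 : Floccari2026_fixedFourfold_kum4Type)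
    (hGS : GoettscheSoergel1993_chiY_kum4Type)
    (hGK : GreenKimLazaRobles2022_llvTrivial_isOfHodgeType_kumType)
    (hF : Foster2024_translationAction_kum4Type)
    (hFu : Fulton1998_cupPairing_transversalPoint)
    (hFV : FloccariVaresco2024_autFixingH2H3_equiv_kumType)
    (h125 : HassettTschinkel2013_Oguiso2020_fixedPointScheme_translation_kum4Type)
    (hL1 : LefschetzGenerationKum4) :
    Summit.Ventures.HodgeKum4.Kum4FixedFourfoldClasses :=
  kum4FixedFourfoldClasses_of_L1_of_split125 hA1 hA2 hGS hGK hF hFu hFV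
    Milne2017_fixedComponent_dim_eq_finrank_tangentFixed_holds h125 hL1

/-- **L3° `Kum4NonInvariantClassesAlgebraic` — the statement of item stmt-Ventures-19135, by name — from EIGHT
named facts + L1** (SEVEN REFEREED + F125X): `kum4NonInvariantClassesAlgebraic_of_L1_of_split125` (p471473) with
the tangent-dimension binder supplied by the tree theorem.  CONDITIONAL on all nine; this does not close the item
(its own signature is not proved outright). -/
theorem kum4NonInvariantClassesAlgebraic_of_L1_of_split125'
    (hA1 : Hirzebruch1969_gSignature_involution_halfDimFixedLocus)
    (hA2 : Floccari2026_fixedFourfold_kum4Type)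
    (hGS : GoettscheSoergel1993_chiY_kum4Type)
    (hGK : GreenKimLazaRobles2022_llvTrivial_isOfHodgeType_kumType)
    (hF : Foster2024_translationAction_kum4Type)
    (hFu : Fulton1998_cupPairing_transversalPoint)
    (hFV : FloccariVaresco2024_autFixingH2H3_equiv_kumType)
    (h125 : HassettTschinkel2013_Oguiso2020_fixedPointScheme_translation_kum4Type)
    (hL1 : LefschetzGenerationKum4) :
    Summit.Ventures.HodgeKum4.Kum4NonInvariantClassesAlgebraic :=
  kum4NonInvariantClassesAlgebraic_of_L1_of_split125 hA1 hA2 hGS hGK hF hFu hFV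
    Milne2017_fixedComponent_dim_eq_finrank_tangentFixed_holds h125 hL1

/-- **Bill A‴ of record with TWELVE binders: H3 for `Kum⁴`-type and its powers from ELEVEN NAMED FACTS + L1** —
TEN REFEREED named facts (O'Grady–Voisin `KS ~ J³`, Floccari–Fu, Foster `B(X)`, Hirzebruch `g`-signature, Floccari's
fixed fourfold, Göttsche–Soergel `χ_y`, GKLR LLV-trivial classes, Foster's translation action, Fulton's transversal
pairing, `Γ ≅ (ℤ/5)⁴`), ONE PRINT-SYNTHESIS named fact (F125X:
`HassettTschinkel2013_Oguiso2020_fixedPointScheme_translation_kum4Type`) and p1's cell lemma L1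
`LefschetzGenerationKum4`: `hc_kum4Type_of_L1_of_split125''` (p471473) with its tangent-dimension binder supplied by
the tree theorem `Milne2017_fixedComponent_dim_eq_finrank_tangentFixed_holds` (the André and Hodge-index binders were
supplied there, `|Γ| = 625` folded into `Γ ≅ (ℤ/5)⁴`).  NO transport (T), NO Kummer-point input, NO (H2).
CONDITIONAL on all twelve; nothing here says `HC_Kum4Type` or the Hodge conjecture is proved outright. -/
theorem hc_kum4Type_of_L1_of_split125'''
    (hOGV : OGradyVoisin2022_thirdJacobian_kugaSatake_kummerType)
    (hFF : FloccariFu2026_hodgeClasses_algebraic_powers_discOneWeilFourfold)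
    (hFo : Foster2024_lefschetzStandard_kummerType_prime)
    (hA1 : Hirzebruch1969_gSignature_involution_halfDimFixedLocus)
    (hA2 : Floccari2026_fixedFourfold_kum4Type)
    (hGS : GoettscheSoergel1993_chiY_kum4Type)
    (hGK : GreenKimLazaRobles2022_llvTrivial_isOfHodgeType_kumType)
    (hF : Foster2024_translationAction_kum4Type)
    (hFu : Fulton1998_cupPairing_transversalPoint)
    (hFV : FloccariVaresco2024_autFixingH2H3_equiv_kumType)
    (h125 : HassettTschinkel2013_Oguiso2020_fixedPointScheme_translation_kum4Type)
    (hL1 : LefschetzGenerationKum4) :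
    Summit.Ventures.HodgeKum4.HC_Kum4Type ∧ Summit.Ventures.HodgeKum4.HC_Kum4TypePowers :=
  hc_kum4Type_of_L1_of_split125'' hOGV hFF hFo hA1 hA2 hGS hGK hF hFu hFV
    Milne2017_fixedComponent_dim_eq_finrank_tangentFixed_holds h125 hL1

/-- **Bill A′ with THIRTEEN binders: H3 for `Kum⁴`-type and its powers from REFEREED PRINT + the transport synthesis
(T) + L1** — `hc_kum4Type_of_L1_of_tangentFixed'''` (p471473) with its tangent-dimension binder supplied by the tree
theorem: twelve printed statements (eleven refereed — O'Grady–Voisin, Floccari–Fu, Foster `B`, Hirzebruch,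
Floccari's fixed fourfold, Göttsche–Soergel, GKLR, Foster's translation action, Fulton, `Γ ≅ (ℤ/5)⁴`, Oguiso's split
fixed points; one print-synthesis: the cohomological transport (T)) and L1.  CONDITIONAL on all thirteen; nothing
here says `HC_Kum4Type` or the Hodge conjecture is proved outright. -/
theorem hc_kum4Type_of_L1_of_tangentFixed''''
    (hOGV : OGradyVoisin2022_thirdJacobian_kugaSatake_kummerType)
    (hFF : FloccariFu2026_hodgeClasses_algebraic_powers_discOneWeilFourfold)
    (hFo : Foster2024_lefschetzStandard_kummerType_prime)
    (hA1 : Hirzebruch1969_gSignature_involution_halfDimFixedLocus)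
    (hA2 : Floccari2026_fixedFourfold_kum4Type)
    (hGS : GoettscheSoergel1993_chiY_kum4Type)
    (hGK : GreenKimLazaRobles2022_llvTrivial_isOfHodgeType_kumType)
    (hF : Foster2024_translationAction_kum4Type)
    (hFu : Fulton1998_cupPairing_transversalPoint)
    (hFV : FloccariVaresco2024_autFixingH2H3_equiv_kumType)
    (hTr : HassettTschinkel2013_Floccari2026_fixedFourfoldClass_transport_kum4Type)
    (hOg : Oguiso2020_fixedPointScheme_translation_generalizedKummerFour)
    (hL1 : LefschetzGenerationKum4) :
    Summit.Ventures.HodgeKum4.HC_Kum4Type ∧ Summit.Ventures.HodgeKum4.HC_Kum4TypePowers :=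
  hc_kum4Type_of_L1_of_tangentFixed''' hOGV hFF hFo hA1 hA2 hGS hGK hF hFu hFV hTr hOg
    Milne2017_fixedComponent_dim_eq_finrank_tangentFixed_holds hL1

end Summit.Ventures.HodgeKum4

end
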